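import Summits.ResolutionOfSingularities.ResolutionOfSingularities.Theorems.FrobeniusLadderFInjectiveMacaulayficationNewtonChartLemmaInitialForm
import Mathlib.LinearAlgebra.Matrix.Nondegenerate
import Mathlib.LinearAlgebra.Matrix.NonsingularInverse
import HarnessLib

/-!
# Q8a (W-ND, the tame class rung): ★★ ISHII'S CHART LEMMA 4.4.24 AS A TREE THEOREM, fan-free — on a unimodular monomial chart refining the dual Newton fan, the
# strict transform of a Newton non-degenerate hypersurface is smooth along, and transversal to, every torus orbit lying over the origin
# (crux `FInjectiveMacaulayfication` stmt-ResolutionOfSingularities-15315, chain w45a; res-L1-w45a-plan-1 RULING R21.4 (2) «Q8a» — the body of the courtesy draft's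
# `IshiiLemma4424` VERBATIM (inlined `θ_V`, unimodularity as `IsUnit (V.map Nat.cast).det`); seat res-L1-w45a-stub-1 g12; source Ishii, *Introduction to Singularities*
# (1997) Lemma 4.4.24 with its proof [corpus:book:ishii1997-introduction-singularities p.96–97], read via res-L1-w45a-tri-2's cross-read l.82239 (argue with the
# `X_j ∂_j` system, no weighted Euler identity in characteristic `p`))

[OURS · L1 W4.5a] Support file (`--supports stmt-ResolutionOfSingularities-15315 --as helper`); def-free; UNCONDITIONAL; NO named fact — the lemma is PROVED here, over ANY
field, for `k`-rational points. NOT a statement of any manuscript of the summit. AI-written (AI review is weaker than expert review).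

SETTING. `f ∈ k[X_0..X_{m-1}]` Newton non-degenerate; `V ∈ ℕ^{m×m}` unimodular (`det = ±1`), the monomial substitution `θ_V : X_j ↦ ∏_i Y_i^{V i j}` (ROW `i` of `V` = the ray
of the divisor `Y_i = 0`); `θ_V f = Y^e · g` with `g(0) ≠ 0` («the cone of `V` refines the dual Newton fan»); `S ≠ ∅` a set of rows with `Σ_{i∈S} row i` strictly positive
(«the orbit `orb τ_S = {Y_i = 0 ⟺ i ∈ S}` lies over the origin»). The abstraction trick that keeps the file def-free: the exponent map `v α = V·α`, the torus point
`x_j = ∏_{i∉S} y_i^{V i j}` and the unit `C = ∏_{i∉S} y_i^{e_i}` are VARIABLES with defining hypotheses (`hv`, `hx`, `hC`).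
* §1 `θ_V` on monomials and sums (`aeval_monomial_eq`, `aeval_eq_sum`), injectivity of `v` from unimodularity (`v_injective`), `coeff_aeval`, `le_v_of_mem_support` (`e ≤ v α`),
  ★ `g_eq_sum` (`g = Σ_α a_α Y^{vα − e}`), `exists_v_eq` (`g(0) ≠ 0 ⇒` some `vα₀ = e`);
* §2 the face: `weight_eq`, ★ `mem_face_iff` — the exponents `α` with `(vα)_i = e_i (i ∈ S)` are EXACTLY those of minimal `(Σ_{i∈S} row i)`-weight;
* §3 evaluation at a point `y` of the orbit: `eval_monomial_eq_zero_of_exists`, `eval_monomial_eq_of_forall`, `mul_eval_pderiv_monomial` (`y_l · ∂_l(cY^β)(y) = β_l · cY^β(y)`);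
* §4 transport to the torus point `x`: `eval_x_monomial`, ★ `C_mul_eval_g` (`C·g(y) = f_F(x)`), ★ `C_mul_mul_eval_pderiv_g` (`l ∉ S`), `sum_V_mul_u`, `W_of_mem` (`l ∈ S`);
* §5 ★★ `ishii_lemma_4_4_24` — **`g(y) = 0 ⟹ ∃ i ∉ S, ∂g/∂Y_i (y) ≠ 0`**: otherwise `V·u = 0` for `u_j = (X_j ∂_j f_F)(x)`, so `u = 0` (unimodular ⇒ `det ≠ 0` in `k`), so `x` is a
  torus zero of the Jacobian of the face polynomial `f_F` = the initial form along the positive weight `Σ_{i∈S} row i` — contradicting non-degeneracy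
  (`NewtonChartLemma.exists_eval_pderiv_ne_zero_of_isNewtonNondegenerate`).
[cite: IshiiSingularities2018, Lemma 4.4.24 (pp. 96–97)]
-/

-- single-problem summit: the doubled namespace component is forced
set_option linter.dupNamespace false

noncomputable section

open MvPolynomial

namespace Summit.ResolutionOfSingularities.ResolutionOfSingularities.Theorems.FInjectiveMacaulayfication.NewtonChartLemma

open Literature.AlgebraicGeometry.Resolution Literature.AlgebraicGeometry.Resolution.BoubakriGreuelMarkwig

variable {k : Type} [Field k] {m : ℕ}

/-! ## §1 The monomial substitution `θ_V` -/

/-- `θ_V (c·X^α) = c·Y^{V·α}`. [certificate] -/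
theorem aeval_monomial_eq (V : Matrix (Fin m) (Fin m) ℕ) (α : Fin m →₀ ℕ) (c : k) (vα : Fin m →₀ ℕ) (hv : ∀ i, vα i = ∑ j, V i j * α j) :
    aeval (fun j : Fin m => ∏ i : Fin m, (X i : MvPolynomial (Fin m) k) ^ V i j) (monomial α c) = monomial vα c := by
  rw [aeval_monomial, Finsupp.prod_fintype _ _ (fun i => by simp), monomial_eq, Finsupp.prod_fintype _ _ (fun i => by simp), MvPolynomial.algebraMap_eq]
  congr 1
  have h1 : ∀ j : Fin m, (∏ i : Fin m, (X i : MvPolynomial (Fin m) k) ^ V i j) ^ (α j) = ∏ i : Fin m, (X i : MvPolynomial (Fin m) k) ^ (V i j * α j) := by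
    intro j
    rw [← Finset.prod_pow]
    exact Finset.prod_congr rfl fun i _ => by rw [pow_mul]
  simp_rw [h1]
  rw [Finset.prod_comm]
  exact Finset.prod_congr rfl fun i _ => by rw [Finset.prod_pow_eq_pow_sum, hv i]

/-- `θ_V f = Σ_{α ∈ supp f} a_α · Y^{V·α}`. [certificate] -/
theorem aeval_eq_sum (V : Matrix (Fin m) (Fin m) ℕ) (f : MvPolynomial (Fin m) k) (v : (Fin m →₀ ℕ) → (Fin m →₀ ℕ)) (hv : ∀ α i, v α i = ∑ j, V i j * α j) :
    aeval (fun j : Fin m => ∏ i : Fin m, (X i : MvPolynomial (Fin m) k) ^ V i j) f = ∑ α ∈ f.support, monomial (v α) (coeff α f) := by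
  conv_lhs => rw [f.as_sum]
  rw [map_sum]
  exact Finset.sum_congr rfl fun α _ => aeval_monomial_eq V α _ (v α) (hv α)

/-- `V·α` read in `ℤ`: the cast of `(vα)_i` is the `i`-th entry of `(V : ℤ-matrix) · α`. [plumbing] -/
theorem cast_v_eq_mulVec (V : Matrix (Fin m) (Fin m) ℕ) (α : Fin m →₀ ℕ) (vα : Fin m →₀ ℕ) (hv : ∀ i, vα i = ∑ j, V i j * α j) (i : Fin m) :
    ((vα i : ℕ) : ℤ) = ((V.map (Nat.cast : ℕ → ℤ)).mulVec (fun j => (α j : ℤ))) i := by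
  rw [hv i, Matrix.mulVec, dotProduct]
  push_cast
  simp [Matrix.map_apply]

/-- UNIMODULARITY ⇒ the exponent map `α ↦ V·α` is injective. [folklore] -/
theorem v_injective (V : Matrix (Fin m) (Fin m) ℕ) (hV : IsUnit (V.map (Nat.cast : ℕ → ℤ)).det) (v : (Fin m →₀ ℕ) → (Fin m →₀ ℕ))
    (hv : ∀ α i, v α i = ∑ j, V i j * α j) : Function.Injective v := by
  intro α β hαβ
  have hzero : (V.map (Nat.cast : ℕ → ℤ)).mulVec (fun j => (α j : ℤ) - (β j : ℤ)) = 0 := by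
    have hsub : (fun j => (α j : ℤ) - (β j : ℤ)) = (fun j => (α j : ℤ)) - (fun j => (β j : ℤ)) := rfl
    rw [hsub, Matrix.mulVec_sub]
    ext i
    rw [Pi.sub_apply, ← cast_v_eq_mulVec V α (v α) (hv α) i, ← cast_v_eq_mulVec V β (v β) (hv β) i, hαβ, sub_self, Pi.zero_apply]
  have h := Matrix.eq_zero_of_mulVec_eq_zero hV.ne_zero hzero
  ext j
  have hj := congr_fun h j
  simp only [Pi.zero_apply, sub_eq_zero, Nat.cast_inj] at hj
  exact hj

/-- The coefficient of `Y^{V·α}` in `θ_V f` is `a_α`. [certificate] -/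
theorem coeff_aeval (V : Matrix (Fin m) (Fin m) ℕ) (hV : IsUnit (V.map (Nat.cast : ℕ → ℤ)).det) (f : MvPolynomial (Fin m) k)
    (v : (Fin m →₀ ℕ) → (Fin m →₀ ℕ)) (hv : ∀ α i, v α i = ∑ j, V i j * α j) (α : Fin m →₀ ℕ) :
    coeff (v α) (aeval (fun j : Fin m => ∏ i : Fin m, (X i : MvPolynomial (Fin m) k) ^ V i j) f) = coeff α f := by
  classical
  rw [aeval_eq_sum V f v hv, coeff_sum]
  simp only [coeff_monomial]
  have hinj := v_injective V hV v hv
  rw [Finset.sum_eq_single α]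
  · rw [if_pos rfl]
  · intro β _ hβ
    rw [if_neg (fun h => hβ (hinj h))]
  · intro hα
    rw [if_pos rfl]
    exact (MvPolynomial.notMem_support_iff.mp hα)

/-- `e ≤ V·α` for every exponent `α` of `f` (the strict transform `g` is a polynomial). [certificate] -/
theorem le_v_of_mem_support (V : Matrix (Fin m) (Fin m) ℕ) (hV : IsUnit (V.map (Nat.cast : ℕ → ℤ)).det) (f : MvPolynomial (Fin m) k)
    (v : (Fin m →₀ ℕ) → (Fin m →₀ ℕ)) (hv : ∀ α i, v α i = ∑ j, V i j * α j) (e : Fin m →₀ ℕ) (g : MvPolynomial (Fin m) k)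
    (hθ : aeval (fun j : Fin m => ∏ i : Fin m, (X i : MvPolynomial (Fin m) k) ^ V i j) f = monomial e 1 * g)
    (α : Fin m →₀ ℕ) (hα : α ∈ f.support) : e ≤ v α := by
  classical
  have hc := coeff_aeval V hV f v hv α
  rw [hθ, coeff_monomial_mul'] at hc
  by_contra hle
  rw [if_neg hle] at hc
  exact (MvPolynomial.mem_support_iff.mp hα) hc.symm

/-- ★ **THE STRICT TRANSFORM, EXPANDED**: `g = Σ_{α ∈ supp f} a_α · Y^{V·α − e}`. [certificate] -/
theorem g_eq_sum (V : Matrix (Fin m) (Fin m) ℕ) (hV : IsUnit (V.map (Nat.cast : ℕ → ℤ)).det) (f : MvPolynomial (Fin m) k)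
    (v : (Fin m →₀ ℕ) → (Fin m →₀ ℕ)) (hv : ∀ α i, v α i = ∑ j, V i j * α j) (e : Fin m →₀ ℕ) (g : MvPolynomial (Fin m) k)
    (hθ : aeval (fun j : Fin m => ∏ i : Fin m, (X i : MvPolynomial (Fin m) k) ^ V i j) f = monomial e 1 * g) :
    g = ∑ α ∈ f.support, monomial (v α - e) (coeff α f) := by
  have hne : (monomial e (1 : k) : MvPolynomial (Fin m) k) ≠ 0 := monomial_eq_zero.not.mpr one_ne_zero
  refine mul_left_cancel₀ hne ?_
  rw [← hθ, aeval_eq_sum V f v hv, Finset.mul_sum]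
  refine Finset.sum_congr rfl fun α hα => ?_
  rw [monomial_mul, one_mul, add_tsub_cancel_of_le (le_v_of_mem_support V hV f v hv e g hθ α hα)]

/-- `g(0) ≠ 0 ⇒` some exponent `α₀` of `f` has `V·α₀ = e` (one vertex minimises every row weight). [certificate] -/
theorem exists_v_eq (V : Matrix (Fin m) (Fin m) ℕ) (hV : IsUnit (V.map (Nat.cast : ℕ → ℤ)).det) (f : MvPolynomial (Fin m) k)
    (v : (Fin m →₀ ℕ) → (Fin m →₀ ℕ)) (hv : ∀ α i, v α i = ∑ j, V i j * α j) (e : Fin m →₀ ℕ) (g : MvPolynomial (Fin m) k)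
    (hθ : aeval (fun j : Fin m => ∏ i : Fin m, (X i : MvPolynomial (Fin m) k) ^ V i j) f = monomial e 1 * g) (hg0 : constantCoeff g ≠ 0) :
    ∃ α₀ ∈ f.support, v α₀ = e := by
  classical
  by_contra hcon
  push Not at hcon
  apply hg0
  rw [constantCoeff_eq, g_eq_sum V hV f v hv e g hθ, coeff_sum]
  refine Finset.sum_eq_zero fun α hα => ?_
  rw [coeff_monomial, if_neg]
  intro h0
  have hle := le_v_of_mem_support V hV f v hv e g hθ α hα
  exact hcon α hα (le_antisymm (tsub_eq_zero_iff_le.mp h0) hle)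

/-! ## §2 The face exposed by `Σ_{i ∈ S} row i` -/

/-- The `(Σ_{i∈S} row i)`-weight of `α` is `Σ_{i∈S} (V·α)_i`. [plumbing] -/
theorem weight_eq (V : Matrix (Fin m) (Fin m) ℕ) (S : Finset (Fin m)) (α : Fin m →₀ ℕ) (vα : Fin m →₀ ℕ) (hv : ∀ i, vα i = ∑ j, V i j * α j) :
    ∑ j, (∑ i ∈ S, V i j) * α j = ∑ i ∈ S, vα i := by
  simp_rw [hv, Finset.sum_mul]
  rw [Finset.sum_comm]

/-- ★ **THE FACE**: the exponents `α ∈ supp f` with `(V·α)_i = e_i` for all `i ∈ S` are EXACTLY the exponents of minimal `(Σ_{i∈S} row i)`-weight — the face of `Γ₊(f)`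
exposed by that strictly positive weight, i.e. `τ_S*` (compact). [cite: IshiiSingularities2018, p. 96] -/
theorem mem_face_iff (V : Matrix (Fin m) (Fin m) ℕ) (hV : IsUnit (V.map (Nat.cast : ℕ → ℤ)).det) (f : MvPolynomial (Fin m) k)
    (v : (Fin m →₀ ℕ) → (Fin m →₀ ℕ)) (hv : ∀ α i, v α i = ∑ j, V i j * α j) (e : Fin m →₀ ℕ) (g : MvPolynomial (Fin m) k)
    (hθ : aeval (fun j : Fin m => ∏ i : Fin m, (X i : MvPolynomial (Fin m) k) ^ V i j) f = monomial e 1 * g) (hg0 : constantCoeff g ≠ 0)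
    (S : Finset (Fin m)) [DecidablePred fun α : Fin m →₀ ℕ => ∀ i ∈ S, v α i = e i] (α : Fin m →₀ ℕ) :
    α ∈ f.support.filter (fun α => ∀ i ∈ S, v α i = e i) ↔
      α ∈ f.support ∧ ∀ β ∈ f.support, ∑ j, (∑ i ∈ S, V i j) * α j ≤ ∑ j, (∑ i ∈ S, V i j) * β j := by
  rw [Finset.mem_filter]
  refine ⟨fun ⟨hα, hF⟩ => ⟨hα, fun β hβ => ?_⟩, fun ⟨hα, hmin⟩ => ⟨hα, ?_⟩⟩
  · rw [weight_eq V S α (v α) (hv α), weight_eq V S β (v β) (hv β)]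
    have hle := le_v_of_mem_support V hV f v hv e g hθ β hβ
    exact Finset.sum_le_sum fun i hi => (hF i hi).symm ▸ hle i
  · obtain ⟨α₀, hα₀, hα₀e⟩ := exists_v_eq V hV f v hv e g hθ hg0
    have h1 := hmin α₀ hα₀
    rw [weight_eq V S α (v α) (hv α), weight_eq V S α₀ (v α₀) (hv α₀), hα₀e] at h1
    have hle := le_v_of_mem_support V hV f v hv e g hθ α hα
    -- termwise `e i ≤ v α i` and the sums compare the other way ⇒ equality termwise
    have heq : ∀ i ∈ S, v α i = e i := by
      by_contra hcon
      push Not at hcon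
      obtain ⟨i, hi, hne⟩ := hcon
      have hlt : e i < v α i := lt_of_le_of_ne (hle i) (Ne.symm hne)
      have : ∑ i ∈ S, e i < ∑ i ∈ S, v α i := Finset.sum_lt_sum (fun j hj => hle j) ⟨i, hi, hlt⟩
      exact absurd h1 (not_le.mpr this)
    exact heq

/-! ## §3 Evaluation at a point of the orbit `{y_i = 0 ⟺ i ∈ S}` -/

/-- A monomial with a positive exponent at some `i ∈ S` vanishes at `y`. [plumbing] -/
theorem eval_monomial_eq_zero_of_exists (S : Finset (Fin m)) (y : Fin m → k) (hy : ∀ i, y i = 0 ↔ i ∈ S) (β : Fin m →₀ ℕ) (c : k)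
    (h : ∃ i ∈ S, β i ≠ 0) : MvPolynomial.eval y (monomial β c) = 0 := by
  obtain ⟨i, hi, hβ⟩ := h
  rw [eval_monomial, Finsupp.prod_fintype _ _ (fun i => by simp)]
  rw [Finset.prod_eq_zero (Finset.mem_univ i) (by rw [(hy i).mpr hi, zero_pow hβ]), mul_zero]

/-- A monomial with zero exponents on `S` evaluates at `y` through the coordinates off `S` only. [plumbing] -/
theorem eval_monomial_eq_of_forall (S : Finset (Fin m)) (y : Fin m → k) (β : Fin m →₀ ℕ) (c : k) (h : ∀ i ∈ S, β i = 0) :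
    MvPolynomial.eval y (monomial β c) = c * ∏ i ∈ Sᶜ, y i ^ β i := by
  rw [eval_monomial, Finsupp.prod_fintype _ _ (fun i => by simp)]
  congr 1
  rw [← Finset.prod_compl_mul_prod S]
  rw [Finset.prod_eq_one (s := S) (fun i hi => by rw [h i hi, pow_zero]), mul_one]

/-- `y_l · ∂_l(c·Y^β)(y) = β_l · (c·Y^β)(y)`. [folklore] -/
theorem mul_eval_pderiv_monomial (y : Fin m → k) (l : Fin m) (β : Fin m →₀ ℕ) (c : k) :
    y l * MvPolynomial.eval y (pderiv l (monomial β c)) = (β l : k) * MvPolynomial.eval y (monomial β c) := by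
  classical
  rw [pderiv_monomial]
  by_cases hl : β l = 0
  · rw [hl, Nat.cast_zero, mul_zero, monomial_zero, map_zero, mul_zero, zero_mul]
  · have hβl : 1 ≤ β l := Nat.one_le_iff_ne_zero.mpr hl
    rw [eval_monomial, eval_monomial, Finsupp.prod_fintype _ _ (fun i => by simp), Finsupp.prod_fintype _ _ (fun i => by simp)]
    rw [← Finset.mul_prod_erase Finset.univ _ (Finset.mem_univ l), ← Finset.mul_prod_erase Finset.univ (fun i => y i ^ β i) (Finset.mem_univ l)]
    have hrest : ∏ i ∈ Finset.univ.erase l, y i ^ (β - Finsupp.single l 1 : Fin m →₀ ℕ) i = ∏ i ∈ Finset.univ.erase l, y i ^ β i :=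
      Finset.prod_congr rfl fun i hi => by rw [Finsupp.tsub_apply, Finsupp.single_eq_of_ne (Finset.ne_of_mem_erase hi), tsub_zero]
    rw [hrest, Finsupp.tsub_apply, Finsupp.single_eq_same]
    have hpow : y l * y l ^ (β l - 1) = y l ^ β l := by rw [← pow_succ', Nat.sub_add_cancel hβl]
    calc y l * (c * ↑(β l) * (y l ^ (β l - 1) * ∏ i ∈ Finset.univ.erase l, y i ^ β i))
        = c * ↑(β l) * ((y l * y l ^ (β l - 1)) * ∏ i ∈ Finset.univ.erase l, y i ^ β i) := by ring
      _ = (β l : k) * (c * (y l ^ β l * ∏ i ∈ Finset.univ.erase l, y i ^ β i)) := by rw [hpow]; ring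

/-! ## §4 Transport to the torus point `x_j = ∏_{i ∉ S} y_i^{V i j}` -/

/-- `(c·X^α)(x) = c · ∏_{i∉S} y_i^{(V·α)_i}`. [certificate] -/
theorem eval_x_monomial (V : Matrix (Fin m) (Fin m) ℕ) (S : Finset (Fin m)) (y x : Fin m → k) (hx : ∀ j, x j = ∏ i ∈ Sᶜ, y i ^ V i j)
    (α : Fin m →₀ ℕ) (c : k) (vα : Fin m →₀ ℕ) (hv : ∀ i, vα i = ∑ j, V i j * α j) :
    MvPolynomial.eval x (monomial α c) = c * ∏ i ∈ Sᶜ, y i ^ vα i := by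
  rw [eval_monomial, Finsupp.prod_fintype _ _ (fun i => by simp)]
  congr 1
  simp_rw [hx, ← Finset.prod_pow]
  rw [Finset.prod_comm]
  refine Finset.prod_congr rfl fun i _ => ?_
  rw [hv i, ← Finset.prod_pow_eq_pow_sum]
  exact Finset.prod_congr rfl fun j _ => by rw [pow_mul]

/-- ★ `C · g(y) = f_F(x)` with `C = ∏_{i∉S} y_i^{e_i}`, `f_F = Σ_{α ∈ F} a_α X^α` the face polynomial. [cite: IshiiSingularities2018, p. 96, (4.13)] -/
theorem C_mul_eval_g (V : Matrix (Fin m) (Fin m) ℕ) (hV : IsUnit (V.map (Nat.cast : ℕ → ℤ)).det) (f : MvPolynomial (Fin m) k)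
    (v : (Fin m →₀ ℕ) → (Fin m →₀ ℕ)) (hv : ∀ α i, v α i = ∑ j, V i j * α j) (e : Fin m →₀ ℕ) (g : MvPolynomial (Fin m) k)
    (hθ : aeval (fun j : Fin m => ∏ i : Fin m, (X i : MvPolynomial (Fin m) k) ^ V i j) f = monomial e 1 * g)
    (S : Finset (Fin m)) [DecidablePred fun α : Fin m →₀ ℕ => ∀ i ∈ S, v α i = e i] (y : Fin m → k) (hy : ∀ i, y i = 0 ↔ i ∈ S)
    (x : Fin m → k) (hx : ∀ j, x j = ∏ i ∈ Sᶜ, y i ^ V i j) (C : k) (hC : C = ∏ i ∈ Sᶜ, y i ^ e i) :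
    C * MvPolynomial.eval y g =
      MvPolynomial.eval x (∑ α ∈ f.support.filter (fun α => ∀ i ∈ S, v α i = e i), monomial α (coeff α f)) := by
  rw [g_eq_sum V hV f v hv e g hθ, map_sum, map_sum, Finset.mul_sum, Finset.sum_filter]
  refine Finset.sum_congr rfl fun α hα => ?_
  have hle := le_v_of_mem_support V hV f v hv e g hθ α hα
  split_ifs with hF
  · rw [eval_monomial_eq_of_forall S y (v α - e) _ (fun i hi => by rw [Finsupp.tsub_apply, hF i hi, tsub_self]),
      eval_x_monomial V S y x hx α _ (v α) (hv α), hC, mul_left_comm, ← Finset.prod_mul_distrib]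
    congr 1
    exact Finset.prod_congr rfl fun i _ => by rw [← pow_add, Finsupp.tsub_apply, add_tsub_cancel_of_le (hle i)]
  · rw [eval_monomial_eq_zero_of_exists S y hy (v α - e) _ ?_, mul_zero]
    by_contra hcon
    push Not at hcon
    exact hF fun i hi => le_antisymm (tsub_eq_zero_iff_le.mp (hcon i hi)) (hle i)

/-- ★ For `l ∉ S`: `C · y_l · ∂_l g (y) = Σ_{α∈F} a_α (V·α)_l ∏_{i∉S} y_i^{(V·α)_i} − e_l · f_F(x)`. [cite: IshiiSingularities2018, p. 96, (4.12)] -/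
theorem C_mul_mul_eval_pderiv_g (V : Matrix (Fin m) (Fin m) ℕ) (hV : IsUnit (V.map (Nat.cast : ℕ → ℤ)).det) (f : MvPolynomial (Fin m) k)
    (v : (Fin m →₀ ℕ) → (Fin m →₀ ℕ)) (hv : ∀ α i, v α i = ∑ j, V i j * α j) (e : Fin m →₀ ℕ) (g : MvPolynomial (Fin m) k)
    (hθ : aeval (fun j : Fin m => ∏ i : Fin m, (X i : MvPolynomial (Fin m) k) ^ V i j) f = monomial e 1 * g)
    (S : Finset (Fin m)) [DecidablePred fun α : Fin m →₀ ℕ => ∀ i ∈ S, v α i = e i] (y : Fin m → k) (hy : ∀ i, y i = 0 ↔ i ∈ S)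
    (x : Fin m → k) (hx : ∀ j, x j = ∏ i ∈ Sᶜ, y i ^ V i j) (C : k) (hC : C = ∏ i ∈ Sᶜ, y i ^ e i) (l : Fin m) :
    C * (y l * MvPolynomial.eval y (pderiv l g)) =
      (∑ α ∈ f.support.filter (fun α => ∀ i ∈ S, v α i = e i), coeff α f * (v α l : k) * ∏ i ∈ Sᶜ, y i ^ v α i) -
      (e l : k) * MvPolynomial.eval x (∑ α ∈ f.support.filter (fun α => ∀ i ∈ S, v α i = e i), monomial α (coeff α f)) := by
  rw [g_eq_sum V hV f v hv e g hθ, map_sum, map_sum, map_sum, Finset.mul_sum, Finset.mul_sum, Finset.mul_sum, Finset.sum_filter, Finset.sum_filter,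
    ← Finset.sum_sub_distrib]
  refine Finset.sum_congr rfl fun α hα => ?_
  have hle := le_v_of_mem_support V hV f v hv e g hθ α hα
  rw [mul_eval_pderiv_monomial y l (v α - e) (coeff α f)]
  split_ifs with hF
  · rw [eval_monomial_eq_of_forall S y (v α - e) _ (fun i hi => by rw [Finsupp.tsub_apply, hF i hi, tsub_self]),
      eval_x_monomial V S y x hx α _ (v α) (hv α), Finsupp.tsub_apply, Nat.cast_sub (hle l), hC]
    have hprod : (∏ i ∈ Sᶜ, y i ^ e i) * ∏ i ∈ Sᶜ, y i ^ (v α - e) i = ∏ i ∈ Sᶜ, y i ^ v α i := by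
      rw [← Finset.prod_mul_distrib]
      exact Finset.prod_congr rfl fun i _ => by rw [← pow_add, Finsupp.tsub_apply, add_tsub_cancel_of_le (hle i)]
    calc (∏ i ∈ Sᶜ, y i ^ e i) * ((((v α l : ℕ) : k) - ((e l : ℕ) : k)) * (coeff α f * ∏ i ∈ Sᶜ, y i ^ (v α - e) i))
        = (((v α l : ℕ) : k) - ((e l : ℕ) : k)) * coeff α f * ((∏ i ∈ Sᶜ, y i ^ e i) * ∏ i ∈ Sᶜ, y i ^ (v α - e) i) := by ring
      _ = coeff α f * (v α l : k) * ∏ i ∈ Sᶜ, y i ^ v α i - (e l : k) * (coeff α f * ∏ i ∈ Sᶜ, y i ^ v α i) := by rw [hprod]; ring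
  · rw [eval_monomial_eq_zero_of_exists S y hy (v α - e) _ ?_, mul_zero, mul_zero, sub_self]
    by_contra hcon
    push Not at hcon
    exact hF fun i hi => le_antisymm (tsub_eq_zero_iff_le.mp (hcon i hi)) (hle i)

/-- `Σ_j V l j · (X_j ∂_j f_F)(x) = Σ_{α∈F} a_α (V·α)_l ∏_{i∉S} y_i^{(V·α)_i}` (the chain rule `Y_l ∂_{Y_l} ∘ θ_V = θ_V ∘ Σ_j V l j · X_j ∂_{X_j}`, evaluated). [folklore] -/
theorem sum_V_mul_u (V : Matrix (Fin m) (Fin m) ℕ) (f : MvPolynomial (Fin m) k) (v : (Fin m →₀ ℕ) → (Fin m →₀ ℕ)) (hv : ∀ α i, v α i = ∑ j, V i j * α j)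
    (F : Finset (Fin m →₀ ℕ)) (S : Finset (Fin m)) (y x : Fin m → k) (hx : ∀ j, x j = ∏ i ∈ Sᶜ, y i ^ V i j) (l : Fin m) :
    ∑ j, (V l j : k) * MvPolynomial.eval x (X j * pderiv j (∑ α ∈ F, monomial α (coeff α f))) =
      ∑ α ∈ F, coeff α f * (v α l : k) * ∏ i ∈ Sᶜ, y i ^ v α i := by
  have hterm : ∀ (j : Fin m) (α : Fin m →₀ ℕ), MvPolynomial.eval x (X j * pderiv j (monomial α (coeff α f))) =
      (α j : k) * (coeff α f * ∏ i ∈ Sᶜ, y i ^ v α i) := by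
    intro j α
    by_cases hxj : x j = 0
    · -- cannot happen in the application, but the identity holds: both sides carry the factor `x_j` … we avoid it by the general identity below
      rw [map_mul, eval_X, ← eval_x_monomial V S y x hx α _ (v α) (hv α), ← mul_eval_pderiv_monomial x j α (coeff α f)]
    · rw [map_mul, eval_X, ← eval_x_monomial V S y x hx α _ (v α) (hv α), ← mul_eval_pderiv_monomial x j α (coeff α f)]
  simp_rw [map_sum (pderiv _), Finset.mul_sum, map_sum, hterm, Finset.mul_sum]
  rw [Finset.sum_comm]
  refine Finset.sum_congr rfl fun α _ => ?_
  rw [hv α l]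
  push_cast
  rw [Finset.mul_sum, Finset.sum_mul]
  exact Finset.sum_congr rfl fun j _ => by ring

/-- For `l ∈ S`: `Σ_{α∈F} a_α (V·α)_l ∏ … = e_l · f_F(x)` (on the face, `(V·α)_l = e_l`). [plumbing] -/
theorem W_of_mem (V : Matrix (Fin m) (Fin m) ℕ) (f : MvPolynomial (Fin m) k) (v : (Fin m →₀ ℕ) → (Fin m →₀ ℕ)) (hv : ∀ α i, v α i = ∑ j, V i j * α j)
    (e : Fin m →₀ ℕ) (S : Finset (Fin m)) [DecidablePred fun α : Fin m →₀ ℕ => ∀ i ∈ S, v α i = e i]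
    (y x : Fin m → k) (hx : ∀ j, x j = ∏ i ∈ Sᶜ, y i ^ V i j) (l : Fin m) (hl : l ∈ S) :
    (∑ α ∈ f.support.filter (fun α => ∀ i ∈ S, v α i = e i), coeff α f * (v α l : k) * ∏ i ∈ Sᶜ, y i ^ v α i) =
      (e l : k) * MvPolynomial.eval x (∑ α ∈ f.support.filter (fun α => ∀ i ∈ S, v α i = e i), monomial α (coeff α f)) := by
  rw [map_sum, Finset.mul_sum]
  refine Finset.sum_congr rfl fun α hα => ?_
  rw [(Finset.mem_filter.mp hα).2 l hl, eval_x_monomial V S y x hx α _ (v α) (hv α)]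
  ring

/-! ## §5 ★★ Ishii's Lemma 4.4.24 -/

/-- `det V = ±1` in `ℤ` ⇒ `det V ≠ 0` in the field `k`. [plumbing] -/
theorem det_cast_ne_zero (V : Matrix (Fin m) (Fin m) ℕ) (hV : IsUnit (V.map (Nat.cast : ℕ → ℤ)).det) : (V.map (Nat.cast : ℕ → k)).det ≠ 0 := by
  have hmap : (V.map (Nat.cast : ℕ → k)) = (Int.castRingHom k).mapMatrix (V.map (Nat.cast : ℕ → ℤ)) := by
    ext i j
    simp
  rw [hmap, ← RingHom.map_det]
  rcases Int.isUnit_iff.mp hV with h | h <;> rw [h] <;> simp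

/-- ★★ **ISHII'S LEMMA 4.4.24 (fan-free chart form, ANY field).** Let `f ∈ k[X_0,…,X_{m-1}]` be Newton non-degenerate (Ishii Def. 4.4.22 = BGM `IsNewtonNondegenerate`), `V` a
UNIMODULAR exponent matrix whose monomial substitution `θ_V : X_j ↦ ∏_i Y_i^{V i j}` satisfies `θ_V f = Y^e · g` with `g(0) ≠ 0` (the cone of `V` refines the dual Newton
fan of `f`), and `S` a set of rows whose sum is a strictly positive weight (the torus orbit `orb τ_S` lies over the origin; `S ≠ ∅` is implied when `m ≥ 1`, so the
courtesy draft's redundant binder `S.Nonempty` is dropped). Then at every `k`-point `y` of the orbit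
(`y_i = 0 ⟺ i ∈ S`) the strict transform `V(g)` is NON-SINGULAR and TRANSVERSAL to the orbit: **`g(y) = 0 ⟹ ∃ i ∉ S, ∂g/∂Y_i (y) ≠ 0`.** Proof (Ishii p. 96–97): otherwise, with
`x_j = ∏_{i∉S} y_i^{V i j}` (a torus point) and `u_j = (X_j ∂_j f_F)(x)` for the face polynomial `f_F` of the weight `Σ_{i∈S} row i`, one gets `V·u = 0` (§4), hence `u = 0`
(unimodularity), hence all `∂_j f_F (x) = 0` — contradicting non-degeneracy along that compact face. [cite: IshiiSingularities2018, Lemma 4.4.24 (pp. 96–97)] -/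
theorem ishii_lemma_4_4_24 (f : MvPolynomial (Fin m) k) (hND : IsNewtonNondegenerate (f : MvPowerSeries (Fin m) k))
    (V : Matrix (Fin m) (Fin m) ℕ) (hV : IsUnit (V.map (Nat.cast : ℕ → ℤ)).det)
    (e : Fin m →₀ ℕ) (g : MvPolynomial (Fin m) k) (hθ : aeval (fun j : Fin m => ∏ i : Fin m, (X i : MvPolynomial (Fin m) k) ^ V i j) f = monomial e 1 * g)
    (hg0 : constantCoeff g ≠ 0) (S : Finset (Fin m)) (hpos : ∀ j : Fin m, 0 < ∑ i ∈ S, V i j)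
    (y : Fin m → k) (hy : ∀ i : Fin m, y i = 0 ↔ i ∈ S) (hgy : MvPolynomial.eval y g = 0) :
    ∃ i : Fin m, i ∉ S ∧ MvPolynomial.eval y (pderiv i g) ≠ 0 := by
  classical
  -- the exponent map, the torus point, the unit
  set v : (Fin m →₀ ℕ) → (Fin m →₀ ℕ) := fun α => Finsupp.equivFunOnFinite.symm fun i => ∑ j, V i j * α j with hvdef
  have hv : ∀ α i, v α i = ∑ j, V i j * α j := fun α i => by simp [hvdef]
  set x : Fin m → k := fun j => ∏ i ∈ Sᶜ, y i ^ V i j with hxdef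
  have hx : ∀ j, x j = ∏ i ∈ Sᶜ, y i ^ V i j := fun j => rfl
  set C : k := ∏ i ∈ Sᶜ, y i ^ e i with hCdef
  have hyT : ∀ i ∈ Sᶜ, y i ≠ 0 := fun i hi h0 => (Finset.mem_compl.mp hi) ((hy i).mp h0)
  have hC0 : C ≠ 0 := Finset.prod_ne_zero_iff.mpr fun i hi => pow_ne_zero _ (hyT i hi)
  have hxT : ∀ j, x j ≠ 0 := fun j => Finset.prod_ne_zero_iff.mpr fun i hi => pow_ne_zero _ (hyT i hi)
  set F := f.support.filter (fun α => ∀ i ∈ S, v α i = e i) with hFdef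
  by_contra hcon
  push Not at hcon
  -- (4.13): `f_F(x) = 0`
  have h13 : MvPolynomial.eval x (∑ α ∈ F, monomial α (coeff α f)) = 0 := by
    have h := C_mul_eval_g V hV f v hv e g hθ S y hy x hx C hCdef
    rw [hgy, mul_zero] at h
    exact h.symm
  -- (4.12): `V · u = 0`
  have hW : ∀ l : Fin m, ∑ j, (V l j : k) * MvPolynomial.eval x (X j * pderiv j (∑ α ∈ F, monomial α (coeff α f))) = 0 := by
    intro l
    rw [sum_V_mul_u V f v hv F S y x hx l]
    by_cases hl : l ∈ S
    · rw [hFdef, W_of_mem V f v hv e S y x hx l hl, ← hFdef, h13, mul_zero]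
    · have h := C_mul_mul_eval_pderiv_g V hV f v hv e g hθ S y hy x hx C hCdef l
      rw [hcon l hl, mul_zero, mul_zero, ← hFdef, h13, mul_zero, sub_zero] at h
      exact h.symm
  have hu : (fun j => MvPolynomial.eval x (X j * pderiv j (∑ α ∈ F, monomial α (coeff α f)))) = 0 := by
    refine Matrix.eq_zero_of_mulVec_eq_zero (det_cast_ne_zero (k := k) V hV) ?_
    ext l
    rw [Matrix.mulVec, dotProduct, Pi.zero_apply]
    simpa [Matrix.map_apply] using hW l
  -- hence all `∂_j f_F (x) = 0` at the torus point `x`: contradiction with non-degeneracy along the face of the weight `Σ_{i∈S} row i`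
  obtain ⟨j, hj⟩ := exists_eval_pderiv_ne_zero_of_isNewtonNondegenerate f hND (fun j => ∑ i ∈ S, V i j) hpos F
    (fun α => by rw [hFdef]; exact mem_face_iff V hV f v hv e g hθ hg0 S α) x hxT
  apply hj
  have hju := congr_fun hu j
  rw [Pi.zero_apply, map_mul, eval_X] at hju
  exact (mul_eq_zero.mp hju).resolve_left (hxT j)

end Summit.ResolutionOfSingularities.ResolutionOfSingularities.Theorems.FInjectiveMacaulayfication.NewtonChartLemma

end
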